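import Literature.Probability.RandomPlanarGeometry.SAWPolygonMadrasBound
import Literature.Probability.RandomPlanarGeometry.SAWPolygonTall

/-!
# The Madras–Hammond polygon join map exists at every length: `JoinMapSpec n` holds for all `n`

N. Madras, *A rigorous bound on the critical exponent for the number of lattice trees, animals, and
polygons*, J. Statist. Phys. 78 (1995) §2; A. Hammond, *An upper bound on the number of self-avoiding
polygons via joining*, Ann. Probab. 46 (2018) §4.1 (arXiv v5), Definition 4.3.  The tree's assembly
`stub_joinMap` (`SAWPolygonJoinMap.lean`) produces, for every `n`, the injective join map of the
specification `JoinMapSpec n` from five named inputs, all of which are theorems of the tree: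
`TallHalf_holds`, `TallHeight_holds` (`SAWPolygonTall`), `CapGadget_holds` (`SAWPolygonJoinCap`),
`UniqueInteriorEqNeck_holds`, `RayParityHoriz_holds` (`SAWPolygonMadrasBound`).  This leaf records
the composition, so that the parametric named fact `JoinMapSpec` carries its `_holds` (D-0026
bookkeeping: the proof term is existing theorems of the tree composed; no statement, definition or
attribute is edited; no new named fact).

## References

* A. Hammond, Ann. Probab. 46 (2018); arXiv:1504.05286v5, §4.1, Definition 4.3. [Hammond2015SAPJoining]
* N. Madras, J. Statist. Phys. 78 (1995), §2. [Madras1995LatticeAnimalsExponent]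
-/

namespace Literature.Probability.RandomPlanarGeometry.SAW.JoinParity

/-- **The join map at length `n`** (a finite domain of size `≥ ½ √n p_n²` mapped injectively into
`SAP_{2n+16}`), unconditionally for every `n`: `stub_joinMap` fed with `TallHalf_holds`,
`TallHeight_holds`, `CapGadget_holds`, `UniqueInteriorEqNeck_holds`, `RayParityHoriz_holds`.
[cite: Hammond2015SAPJoining, Definition 4.3 p. 20 (the Madras join polygon J(τ,σ) ∈ SAP_{n+m+16}; arXiv v5)] -/
theorem JoinMapSpec_holds (n : ℕ) :
    Literature.Probability.RandomPlanarGeometry.SAW.JoinParity.JoinMapSpec n :=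
  stub_joinMap TallHalf_holds TallHeight_holds CapGadget_holds UniqueInteriorEqNeck_holds
    RayParityHoriz_holds n

end Literature.Probability.RandomPlanarGeometry.SAW.JoinParity
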